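import Literature.IUT.LogVolume.InitialThetaDataVolume
import Literature.IUT.HodgeTheaters.InitialThetaDataQRootProofs
import Literature.NumberTheory.EllipticCurves.MultiplicativeReductionBaseChangeTorsionProofs
import Literature.NumberTheory.EllipticCurves.TateCurve.TorsionRootTwo
import HarnessLib

/-!
# [IUTchI] Example 3.2 (iv) for initial Θ-data, unconditionally: `q_v̲` admits a `2l`-th root in `K_v̲`

Proof-only companion (cell `abc-iut`, seat abc-iut-w5-d209) assembling, for `D : InitialThetaData F K Fbar E l Pb`
and a bad place `v ∈ V^bad_mod` with its lift `v̲ = liftPlace D v ∈ V̲^bad`, the printed sentence of Mochizuki,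
*Inter-universal Teichmüller theory I*, Example 3.2 (iv) (kurims May-2020 manuscript p. 71): "Write `q_v` for the
`q`-parameter of the elliptic curve `E_v` over `K_v`. … it follows from our assumption concerning `2`-torsion [cf.
Definition 3.1, (b)], together with the definition of `K` [cf. Definition 3.1, (c)], that `q_v` admits a `2l`-th
root in `𝒪^▷(T_{X̲̲_v}) (≅ 𝒪^▷_{K_v̲})`" — now WITHOUT the split-multiplicative-reduction hypothesis of
`InitialThetaData.exists_pow_two_mul_l_eq_tateParameter` (`InitialThetaDataQRootProofs.lean`), thanks to
abc-iut-w5-d181's `TorsionRootTwist.lean` (odd `n`: `n²` rational points killed by `n` force `q ∈ (K^×)ⁿ` on ANY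
curve with `|j| > 1`, via the norm from `K(√γ)`) and abc-iut-w5-d047's `TorsionRootTwo.lean` (four rational points
killed by `2` force `q ∈ (K^×)²`, via `Δ ≡ □`), assembled there as `exists_pow_two_mul_eq_tateParameter_of_torsion`.

* `ThetaData.one_lt_norm_j_liftPlace` — `|j(E_F)|_{v̲} > 1` (multiplicative reduction of `E_F` below `v̲`, Def. 3.1
  (b); Silverman *AEC* VII.5.1 (b), abc-iut-w5-d158's `one_lt_valuation_j_baseChange_of_hasMultiplicativeReductionAt`);
* `ThetaData.exists_finset_two_torsion_completion`, `…_l_torsion_completion` — `E_F(K_{v̲})` has `4` points killed by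
  `2` and `l²` points killed by `l` (from `InitialThetaData.exists_finset_two_torsion` / `…_l_torsion`, Def. 3.1 (b)(c));
* **`ThetaData.exists_pow_two_mul_l_eq_tateParameter_liftPlace`** — the Tate parameter `q_{v̲} ∈ K_{v̲}` of
  `E_F ×_F K_{v̲}` (`q ≠ 0`, `‖q‖ < 1`, `tateJ q = j(E_F)`) is `r ^ (2l)`, `r ∈ K_{v̲}`, with
  `v̲(j(E_F)) = (v̲ r)⁻¹ ^ (2l)` — no residual hypothesis.

[cite: Mochizuki2012, IUTchI Def. 3.1 (b)(c) pp. 61–62, Ex. 3.2 (iv) p. 71] [cite: SilvermanATAEC1994, V.5.3]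
[claim: Mochizuki2012, status: disputed] for every IUT quotation; the mathematics is classical (Tate–Silverman);
nothing here bears on [IUTchIII] Cor. 3.12 and no side is taken.
-/

noncomputable section

open scoped Classical

namespace Literature.IUT.LogVolume

namespace ThetaData

open Literature.IUT.HodgeTheaters Literature.NumberTheory.EllipticCurves
  Literature.NumberTheory.EllipticCurves.TateCurve Literature.NumberTheory.EllipticCurves.SteinWuthrich2013
  NumberField IsDedekindDomain WeierstrassCurve

variable {F K Fbar : Type} [Field F] [NumberField F] [Field K] [NumberField K] [Algebra F K]
  [Field Fbar] [Algebra F Fbar] [Algebra K Fbar] {E : WeierstrassCurve F} [E.IsElliptic] {l : ℕ}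
  {Pb : BadPlacePredicates K} (D : InitialThetaData F K Fbar E l Pb)

omit [NumberField F] [E.IsElliptic] in
/-- Push-forward of a finset of `K`-points killed by `n` to the completion `K_w`, as points of `(E_F ×_F K) ×_K K_w`
(injective homomorphism `E_F(K) → E_F(K_w)`; the curves `E_F ×_F K_w` and `(E_F ×_F K) ×_K K_w` coincide).
[folklore] -/
private theorem exists_finset_torsion_completion' (w : HeightOneSpectrum (𝓞 K)) {n : ℕ}
    (S : Finset (E.toAffine.baseChange K).Point) (hS : ∀ P ∈ S, n • P = 0) :
    ∃ S' : Finset ((E.baseChange K).baseChange (w.adicCompletion K)).toAffine.Point,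
      S'.card = S.card ∧ ∀ P ∈ S', n • P = 0 := by
  let f : K →ₐ[F] w.adicCompletion K := IsScalarTower.toAlgHom F K (w.adicCompletion K)
  let ι : (E.toAffine.baseChange K).Point →+ (E.toAffine.baseChange (w.adicCompletion K)).Point :=
    Affine.Point.map f
  have hι : Function.Injective ι := Affine.Point.map_injective f
  have hEq : E.baseChange (w.adicCompletion K) = (E.baseChange K).baseChange (w.adicCompletion K) := by
    rw [WeierstrassCurve.baseChange, WeierstrassCurve.baseChange, WeierstrassCurve.baseChange,
      WeierstrassCurve.map_map, ← IsScalarTower.algebraMap_eq]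
  have key : ∀ {W₁ W₂ : WeierstrassCurve (w.adicCompletion K)} (_ : W₁ = W₂) (T : Finset W₁.toAffine.Point),
      (∀ P ∈ T, n • P = 0) → ∃ S' : Finset W₂.toAffine.Point, S'.card = T.card ∧ ∀ P ∈ S', n • P = 0 := by
    rintro W₁ W₂ rfl T hT
    exact ⟨T, rfl, hT⟩
  obtain ⟨S', hS', hS'n⟩ := key hEq (S.map ⟨ι, hι⟩) (by
    intro P hP
    obtain ⟨P₀, hP₀, rfl⟩ := Finset.mem_map.mp hP
    show n • ι P₀ = 0
    rw [← map_nsmul, hS P₀ hP₀, map_zero])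
  exact ⟨S', by rw [hS', Finset.card_map], hS'n⟩

include D in
/-- **`E_F(K_{v̲})` has four points killed by `2`** at every finite place (Def. 3.1 (b) "the `2·3`-torsion points of
`E_F` are rational over `F`"; `InitialThetaData.exists_finset_two_torsion` pushed to the completion).
[claim: Mochizuki2012, status: disputed] -/
theorem exists_finset_two_torsion_completion [IsScalarTower F K Fbar] (w : HeightOneSpectrum (𝓞 K)) :
    ∃ S : Finset ((E.baseChange K).baseChange (w.adicCompletion K)).toAffine.Point,
      S.card = 4 ∧ ∀ P ∈ S, (2 : ℕ) • P = 0 := by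
  obtain ⟨S, hS, hSt⟩ := D.exists_finset_two_torsion
  obtain ⟨S', hS', hS't⟩ := exists_finset_torsion_completion' w S hSt
  exact ⟨S', hS'.trans hS, hS't⟩

include D in
/-- **`E_F(K_{v̲})` has `l²` points killed by `l`** at every finite place (Def. 3.1 (c) "`K := F(E_F[l])`";
`InitialThetaData.exists_finset_l_torsion` pushed to the completion). [claim: Mochizuki2012, status: disputed] -/
theorem exists_finset_l_torsion_completion [IsScalarTower F K Fbar] (w : HeightOneSpectrum (𝓞 K)) :
    ∃ S : Finset ((E.baseChange K).baseChange (w.adicCompletion K)).toAffine.Point,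
      S.card = l ^ 2 ∧ ∀ P ∈ S, l • P = 0 := by
  obtain ⟨S, hS, hSt⟩ := D.exists_finset_l_torsion
  obtain ⟨S', hS', hS't⟩ := exists_finset_torsion_completion' w S hSt
  exact ⟨S', hS'.trans hS, hS't⟩

/-- The place of `F` below `v̲ = liftPlace D v` lies over `v` (`v̲ ∩ 𝓞_{F_mod} = v`, S2's `under_liftPlace`; private
copy of `ThetaData.under_under_liftPlace` of `InitialThetaDataVolumeInhabited.lean` to keep the imports light).
[folklore] -/
private theorem under_under_liftPlace' (v : HeightOneSpectrum (𝓞 (fieldOfModuli E))) :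
    ((liftPlace D v).under (𝓞 F)).under (𝓞 (fieldOfModuli E)) = v := by
  apply HeightOneSpectrum.ext
  rw [HeightOneSpectrum.under_asIdeal, HeightOneSpectrum.under_asIdeal, Ideal.under_under,
    ← HeightOneSpectrum.under_asIdeal, under_liftPlace D v]

/-- **`|j(E_F)|_{v̲} > 1` at `v̲ ∈ V̲^bad`** (for the norm of `K_{v̲}`): `E_F` has multiplicative reduction at the place
of `F` below `v̲` (Def. 3.1 (b)), so `ord_{v̲}(j) < 0` (Silverman *AEC* VII.5.1 (b); w5-d158's
`one_lt_valuation_j_baseChange_of_hasMultiplicativeReductionAt`). [claim: Mochizuki2012, status: disputed] -/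
theorem one_lt_norm_j_liftPlace {v : HeightOneSpectrum (𝓞 (fieldOfModuli E))} (hv : v ∈ badPrimesMod D) :
    letI := Literature.NumberTheory.GaloisRepresentations.Ultrametric.AdicCompletion.nontriviallyNormedField K
      (liftPlace D v)
    1 < ‖((E.baseChange K).baseChange ((liftPlace D v).adicCompletion K)).j‖ := by
  letI := Literature.NumberTheory.GaloisRepresentations.Ultrametric.AdicCompletion.nontriviallyNormedField K
    (liftPlace D v)
  haveI : (liftPlace D v).asIdeal.LiesOver ((liftPlace D v).under (𝓞 F)).asIdeal := ⟨rfl⟩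
  haveI : (E.baseChange K).IsElliptic := inferInstanceAs (E.map (algebraMap F K)).IsElliptic
  have hmult : E.HasMultiplicativeReductionAt ((liftPlace D v).under (𝓞 F)) :=
    hasMultiplicativeReductionAt_of_under D hv (under_under_liftPlace' D v)
  have h1 := E.one_lt_valuation_j_baseChange_of_hasMultiplicativeReductionAt (K := K) (w := liftPlace D v) hmult
  rw [show ((E.baseChange K).baseChange ((liftPlace D v).adicCompletion K)).j =
      algebraMap K _ (E.baseChange K).j from (E.baseChange K).map_j _,
    Valued.toNormedField.one_lt_norm_iff,
    WeierstrassCurve.valued_algebraMap_adicCompletion]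
  exact h1

/-- **[IUTchI] Example 3.2 (iv) for initial Θ-data — `q_{v̲}` admits a `2l`-th root in `K_{v̲}`, unconditionally.**
For `D` a collection of initial Θ-data and `v ∈ V^bad_mod` with lift `v̲ = liftPlace D v ∈ V̲^bad`, the Tate parameter
`q ∈ K_{v̲}` of `E_F ×_F K_{v̲}` (`q ≠ 0`, `‖q‖ < 1`, `tateJ q = j(E_F)`; Silverman ATAEC Lemma V.5.1, the tree's
`tateParameter`) is a `2l`-th power in `K_{v̲}`: "from our assumption concerning `2`-torsion" (four rational points
killed by `2` ⇒ `q ≡ □`, w5-d047) "together with the definition of `K`" (`l²` rational points killed by the odd prime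
`l` ⇒ `q ∈ (K^×)ˡ`, w5-d181), combined by `gcd(2, l) = 1`. No split-reduction hypothesis.
[claim: Mochizuki2012, status: disputed] -/
theorem exists_pow_two_mul_l_eq_tateParameter_liftPlace [IsScalarTower F K Fbar]
    {v : HeightOneSpectrum (𝓞 (fieldOfModuli E))} (hv : v ∈ badPrimesMod D) :
    letI := Literature.NumberTheory.GaloisRepresentations.Ultrametric.AdicCompletion.nontriviallyNormedField K
      (liftPlace D v)
    ∃ q r : (liftPlace D v).adicCompletion K, q ≠ 0 ∧ ‖q‖ < 1 ∧
      tateJ q = algebraMap K ((liftPlace D v).adicCompletion K) (E.baseChange K).j ∧ r ^ (2 * l) = q ∧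
      Valued.v (algebraMap K ((liftPlace D v).adicCompletion K) (E.baseChange K).j) =
        ((Valued.v r)⁻¹) ^ (2 * l) := by
  letI := Literature.NumberTheory.GaloisRepresentations.Ultrametric.AdicCompletion.nontriviallyNormedField K
    (liftPlace D v)
  haveI := charZero_adicCompletion' K (liftPlace D v)
  haveI : (E.baseChange K).IsElliptic := inferInstanceAs (E.map (algebraMap F K)).IsElliptic
  haveI : ((E.baseChange K).baseChange ((liftPlace D v).adicCompletion K)).IsElliptic :=
    inferInstanceAs ((E.baseChange K).map (algebraMap K ((liftPlace D v).adicCompletion K))).IsElliptic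
  set Ew := (E.baseChange K).baseChange ((liftPlace D v).adicCompletion K) with hEw
  have hj : 1 < ‖Ew.j‖ := one_lt_norm_j_liftPlace D hv
  obtain ⟨S₂, hS₂, hS₂t⟩ := exists_finset_two_torsion_completion D (liftPlace D v)
  obtain ⟨Sl, hSl, hSlt⟩ := exists_finset_l_torsion_completion D (liftPlace D v)
  have hodd : Odd l := D.l_prime.odd_of_ne_two (by have := D.five_le_l; omega)
  obtain ⟨c, hc⟩ := exists_pow_two_mul_eq_tateParameter_of_torsion Ew hj S₂ hS₂t (by rw [hS₂]) hodd Sl hSlt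
    (by rw [hSl])
  have hjE : Ew.j = algebraMap K ((liftPlace D v).adicCompletion K) (E.baseChange K).j :=
    (E.baseChange K).map_j _
  have hqv : Valued.v (tateParameter Ew hj) =
      (Valued.v (algebraMap K ((liftPlace D v).adicCompletion K) (E.baseChange K).j))⁻¹ := by
    refine valuation_eq_inv_of_norm_eq_inv K (liftPlace D v) ?_
    rw [← hjE]
    exact norm_tateParameter Ew hj
  refine ⟨tateParameter Ew hj, c, tateParameter_ne_zero Ew hj, norm_tateParameter_lt_one Ew hj, ?_, hc, ?_⟩
  · rw [tateJ_tateParameter Ew hj, hjE]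
  · rw [← inv_inv (Valued.v (algebraMap K ((liftPlace D v).adicCompletion K) (E.baseChange K).j)), ← hqv,
      ← hc, map_pow, inv_pow]

end ThetaData

end Literature.IUT.LogVolume

end
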